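import Literature.NumberTheory.EllipticCurves.TateModule
import Literature.NumberTheory.EllipticCurves.PointDivisibilityProofs
import HarnessLib

/-!
# Discharge of `proj_surjective_of_isAlgClosed`: `T_p E → E[p^n]` is onto (Silverman, *AEC*, III.§7)

Trunk T-ELLARITH; sibling proof file of `Literature.NumberTheory.EllipticCurves.TateModule`
(next to `TateModuleProofs`, `TateModuleRank`, `TateModuleFree`). D-0014 keeps `Literature/`
sorry-free by stating cited results as named facts `def X : Prop`; this file **discharges** the
named fact `WeierstrassCurve.proj_surjective_of_isAlgClosed W p` (every `P ∈ E(F̄)[p^n]` is the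
`n`-th component of an element of `T_p E`, i.e. the projections `T_p E → E[p^n]` are onto) as
`WeierstrassCurve.proj_surjective_of_isAlgClosed_holds`, sorry-free and without hypotheses.

Silverman, *AEC*, 2nd ed., III.§7 (p. 87 of the held text) defines `T_ℓ(E) = lim← E[ℓ^n]`, "the
inverse limit being taken with respect to the natural maps `E[ℓ^{n+1}] --[ℓ]--> E[ℓ^n]`"; these
maps are onto because `[ℓ] : E(K̄) → E(K̄)` is onto — `[m]` is a nonconstant isogeny
(Prop. III.4.2(a), p. 68) and a nonconstant morphism of curves is surjective (Thm. II.2.3, p. 30;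
quantitatively Thm. III.4.10(a)) — and an inverse system of surjections has surjective projections.
Accordingly:

* `Literature.NumberTheory.EllipticCurves.TateModule.exists_proj_eq_of_smul_surjective` (generic): if multiplication by `p` is onto
  the abelian group `A`, every `x ∈ A[p^n]` is `proj p n a` for some `a ∈ T_p A` (iterate a
  section `s` of `[p]`: `a_m := p ^ n • s^m(x)`).
* `WeierstrassCurve.nsmul_geomPoints_surjective`: `[n]` is onto `geomPoints W = E(F̄)` for `n ≠ 0`
  (`n : ℕ`), from the discharged named fact `WeierstrassCurve.zsmul_geomPoints_surjective`
  (`zsmul_geomPoints_surjective_holds`, file `PointDivisibilityProofs`, proved there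
  unconditionally and in every characteristic from `DivisionPolynomialTorsion`).
* `WeierstrassCurve.proj_surjective_of_isAlgClosed_holds : proj_surjective_of_isAlgClosed W p`.

Consumers `(h : proj_surjective_of_isAlgClosed W p)` are fed
`proj_surjective_of_isAlgClosed_holds W p`.

## References

* J. H. Silverman, *The Arithmetic of Elliptic Curves*, 2nd ed., GTM 106, Springer 2009,
  doi:10.1007/978-0-387-09494-6: Thm. II.2.3 (p. 30), Prop. III.4.2(a) (p. 68), Thm. III.4.10(a)
  (p. 71), III.§7 (definition of `T_ℓ(E)`, p. 87). [SilvermanAEC2009]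

## Design

No definitions (pure proof file); `open scoped Classical` as in `TateModule`/`GaloisAction`, so
that `n • P` on `geomPoints W` is the group law of `GaloisAction.lean`.
-/

noncomputable section

open scoped Classical
open scoped AddSubgroup

universe u

namespace Literature.NumberTheory.EllipticCurves

namespace TateModule

variable {A : Type u} [AddCommGroup A] {p : ℕ}

/-- **Surjectivity of the projections `T_p A → A[p^n]` from `p`-divisibility of `A`.** If
multiplication by `p` is surjective on `A`, every `x ∈ A[p^n]` is the `n`-th component of an
element of `T_p A`: for a section `s` of `P ↦ p • P` put `a_m := p ^ n • s^m(x)`; then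
`p ^ m • a_m = p ^ n • x = 0`, `p • a_{m+1} = a_m` and `a_n = p ^ n • s^n(x) = x`. This is the step
"the inverse limit being taken with respect to the natural maps `E[ℓ^{n+1}] --[ℓ]--> E[ℓ^n]`"
(onto, as `[ℓ]` is) of Silverman, *AEC*, III.§7, p. 87. [folklore] -/
theorem exists_proj_eq_of_smul_surjective (hs : Function.Surjective fun P : A => p • P) (n : ℕ)
    {x : A} (hx : x ∈ A[(p ^ n : ℕ)]) : ∃ a : TateModule A p, proj p n a = x := by
  choose s hs using hs
  replace hs : ∀ P : A, p • s P = P := hs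
  have hit : ∀ (k : ℕ) (y : A), p ^ k • s^[k] y = y := by
    intro k
    induction k with
    | zero => intro y; rw [pow_zero, one_smul, Function.iterate_zero_apply]
    | succ k ih => intro y; rw [pow_succ, mul_smul, Function.iterate_succ_apply', hs, ih]
  refine ⟨mk (fun m => p ^ n • s^[m] x) (fun m => ?_) (fun m => ?_), ?_⟩
  · rw [smul_comm, hit]
    exact AddSubgroup.torsionBy.nsmul_iff.mp hx
  · rw [smul_comm, Function.iterate_succ_apply', hs]
  · rw [proj_mk, hit]

end TateModule

end Literature.NumberTheory.EllipticCurves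

namespace WeierstrassCurve

open Literature.NumberTheory.EllipticCurves

variable {F : Type u} [Field F] (W : WeierstrassCurve F) (p : ℕ)

/-- **`[n]` is onto `E(F̄)` for `n ≠ 0`, `n : ℕ`** (Silverman, *AEC*, Prop. III.4.2(a) with
Thm. II.2.3; §VIII.2), for the geometric points `geomPoints W = E(F̄)` with their
`open scoped Classical` group structure of `GaloisAction.lean`: the case `(n : ℤ)` of the named fact
`zsmul_geomPoints_surjective W`, discharged in `PointDivisibilityProofs`
(`zsmul_geomPoints_surjective_holds`). [cite: SilvermanAEC2009, Prop. III.4.2(a) with Thm. II.2.3] -/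
theorem nsmul_geomPoints_surjective [W.IsElliptic] {n : ℕ} (hn : n ≠ 0) :
    Function.Surjective fun P : geomPoints W => n • P := by
  intro P
  obtain ⟨Q, hQ⟩ := zsmul_geomPoints_surjective_holds W (Int.natCast_ne_zero.mpr hn) P
  exact ⟨Q, by simpa only [natCast_zsmul] using hQ⟩

/-- **Silverman, *AEC*, III.§7: the projections `T_p E → E[p^n]` are surjective** — the named fact
`proj_surjective_of_isAlgClosed W p` of `TateModule.lean`, discharged: `[p]` is onto `E(F̄)`
(`nsmul_geomPoints_surjective`, i.e. Prop. III.4.2(a) with Thm. II.2.3, proved in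
`PointDivisibilityProofs`), so every `P ∈ E[p^n]` extends to a compatible sequence
(`Literature.NumberTheory.EllipticCurves.TateModule.exists_proj_eq_of_smul_surjective`), as in the definition of `T_ℓ(E)`, p. 87:
"the inverse limit being taken with respect to the natural maps `E[ℓ^{n+1}] --[ℓ]--> E[ℓ^n]`".
Consumers `(h : proj_surjective_of_isAlgClosed W p)` are fed
`proj_surjective_of_isAlgClosed_holds W p`.
[cite: SilvermanAEC2009, III.§7 (definition of `T_ℓ(E)`, p. 87), Prop. III.4.2(a), Thm. II.2.3] -/
theorem proj_surjective_of_isAlgClosed_holds [Fact p.Prime] :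
    proj_surjective_of_isAlgClosed W p := by
  intro _ n P hP
  exact TateModule.exists_proj_eq_of_smul_surjective
    (nsmul_geomPoints_surjective W (Fact.out : p.Prime).ne_zero) n hP

end WeierstrassCurve
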